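import Literature.MathematicalPhysics.QuantumFieldTheory.QuasiLocalGaugePerturbation
import Literature.Probability.LatticeModels.CoarseCellFiniteSize
import Literature.Probability.LatticeModels.ZModTorusFrames
import HarnessLib

/-!
# Blocks versus coarse cells on the discrete torus

Geometry of two scales on `(ℤ/N)^d`: the BLOCKS of side `b` of the tree's `QuasiLocalGaugePerturbation`
(`blockCorner b x`, Bałaban's cubes) and the coarse CELLS of a product of explicit cyclic frames of
scale `b'` (`axisFrame N b' μ` of `ZModTorusFrames.lean` on every axis; `prodFrame`, `siteCell`,
`cellOf` label sites and links by `CoarseIdx (fun _ => μ)`, the coarse torus of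
`CoarseCellFiniteSize.lean`), at comparable scales `2b ≤ b' ≤ 4b`:

* a cell meets at most `10^d` blocks (`card_image_blockCorner_le_mul_cellCount`);
* sites whose blocks are `M` blocks near are `bM + b - 1` close (`natAbs_valMinAbs_sub_le_of_blockCorner_near`),
  hence links whose blocks are `(2D+1)`-near lie in cells at coarse distance `≤ D + 1`
  (`cdist_cellOf_le_of_blockCorner_near`: labels contract distances by `b' ≥ 2b`);
* on the odd torus `2S+1`, the cells of the links of two finite link sets of `ℤ^d` read mod `2S+1`,
  the second shifted in time by `t ≤ S`, are at coarse distance `≥ t/(2b') - δ₀ - 1`, `δ₀` the sum of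
  the time extents (`le_cdist_cellOf_torusEdge_timeShift`: labels expand distances by `< 2b'`, no
  wrap-around for `t ≤ S`).

These are the geometric inputs that turn block-scale kernel estimates into cell-scale finite-size
conditions. Sources: T. Bałaban, CMP 119 (1988) §1 (block partitions of the torus); R. L. Dobrushin,
S. B. Shlosman (1985) §2 (cubes of cells). The arithmetic is folklore.
-/

noncomputable section

open Literature.Probability.LatticeModels (CoarseIdx cdist cellCount axisFrame axisFrame_eq_imp
  axisFrame_dist_le dist_lt_axisFrame_dist le_natAbs_valMinAbs_sub_add
  card_image_corner_filter_axisFrame_le)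
open Literature.MathematicalPhysics.QuantumLattice

namespace Literature.MathematicalPhysics.QuantumFieldTheory

/-! ### Cells of sites and links -/

section Cells

variable {d N : ℕ} {μc : Fin d → ℕ}

/-- Cell label of a torus site: apply the axis frames coordinatewise. [folklore] -/
def siteCell (q : (i : Fin d) → ZMod N → ZMod (μc i + 1)) (x : Site d N) : CoarseIdx μc :=
  fun i => q i (x i)

/-- Cell label of a torus link = label of its base point. [folklore] -/
def cellOf (q : (i : Fin d) → ZMod N → ZMod (μc i + 1)) (e : Edge d N) : CoarseIdx μc :=
  siteCell q e.1

/-- The product frame: the explicit axis frame of scale `b'` with `μ + 1` cells on every axis of the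
torus of side `N`. [folklore] -/
def prodFrame (N b' μ : ℕ) : (i : Fin d) → ZMod N → ZMod ((fun _ : Fin d => μ) i + 1) :=
  fun _ => axisFrame N b' μ

variable [NeZero N] {b b' μ : ℕ}

/-- The block corners of the sites of one cell number at most `(2b'/b + 2)^d`. [folklore] -/
theorem card_image_blockCorner_filter_siteCell_le (hb : 0 < b) (hb' : 0 < b')
    (h2 : N < μ * b' + 2 * b') (c : CoarseIdx (fun _ : Fin d => μ)) :
    ((Finset.univ.filter fun x : Site d N => siteCell (prodFrame N b' μ) x = c).image
      (blockCorner b)).card ≤ (2 * b' / b + 2) ^ d := by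
  classical
  set T₁ : (i : Fin d) → Finset (ZMod N) := fun i =>
    (Finset.univ.filter fun u : ZMod N => axisFrame N b' μ u = c i).image
      fun u : ZMod N => (((u.val / b * b : ℕ)) : ZMod N)
  have hsub : ((Finset.univ.filter fun x : Site d N => siteCell (prodFrame N b' μ) x = c).image
      (blockCorner b)) ⊆ Fintype.piFinset T₁ := by
    intro y hy
    simp only [Finset.mem_image, Finset.mem_filter, Finset.mem_univ, true_and] at hy
    obtain ⟨x, hx, rfl⟩ := hy
    refine Fintype.mem_piFinset.2 fun i => Finset.mem_image.2 ⟨x i, ?_, rfl⟩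
    exact Finset.mem_filter.2 ⟨Finset.mem_univ _, congrFun hx i⟩
  refine (Finset.card_le_card hsub).trans ?_
  rw [Fintype.card_piFinset]
  calc ∏ i, (T₁ i).card ≤ ∏ _i : Fin d, (2 * b' / b + 2) :=
        Finset.prod_le_prod (fun _ _ => Nat.zero_le _) fun i _ =>
          card_image_corner_filter_axisFrame_le hb hb' h2 (c i)
    _ = (2 * b' / b + 2) ^ d := by simp

/-- **Blocks met by a set of links versus cells met**: at most `10^d` block corners per cell when the
cell sides are `< 2b' ≤ 8b`. [folklore] -/
theorem card_image_blockCorner_le_mul_cellCount (hb : 0 < b) (hb' : 0 < b') (hbb : b' ≤ 4 * b)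
    (h2 : N < μ * b' + 2 * b') (A : Finset (Edge d N)) :
    (A.image fun e => blockCorner b e.1).card ≤ 10 ^ d * cellCount (cellOf (prodFrame N b' μ)) A := by
  unfold cellCount
  set cells := Finset.univ.filter fun c : CoarseIdx (fun _ : Fin d => μ) =>
    ∃ v ∈ A, cellOf (prodFrame N b' μ) v = c
  have hsub : (A.image fun e => blockCorner b e.1) ⊆ cells.biUnion fun c =>
      (Finset.univ.filter fun x : Site d N => siteCell (prodFrame N b' μ) x = c).image
        (blockCorner b) := by
    intro y hy
    obtain ⟨e, he, rfl⟩ := Finset.mem_image.1 hy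
    refine Finset.mem_biUnion.2 ⟨cellOf (prodFrame N b' μ) e, ?_, ?_⟩
    · exact Finset.mem_filter.2 ⟨Finset.mem_univ _, e, he, rfl⟩
    · exact Finset.mem_image.2 ⟨e.1, Finset.mem_filter.2 ⟨Finset.mem_univ _, rfl⟩, rfl⟩
  have h8 : 2 * b' / b ≤ 8 := Nat.div_le_of_le_mul (by omega)
  have h10 : (2 * b' / b + 2) ^ d ≤ 10 ^ d := Nat.pow_le_pow_left (by omega) d
  refine (Finset.card_le_card hsub).trans (Finset.card_biUnion_le.trans ?_)
  calc ∑ c ∈ cells, ((Finset.univ.filter fun x : Site d N =>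
          siteCell (prodFrame N b' μ) x = c).image (blockCorner b)).card
      ≤ ∑ _c ∈ cells, 10 ^ d :=
        Finset.sum_le_sum fun c _ => (card_image_blockCorner_filter_siteCell_le hb hb' h2 c).trans h10
    _ = 10 ^ d * cells.card := by rw [Finset.sum_const, smul_eq_mul, Nat.mul_comm]

/-! ### Nearness of blocks versus coarse distance of cells -/

/-- A site minus its block corner is the remainder, coordinatewise. [folklore] -/
theorem apply_sub_blockCorner (b : ℕ) (x : Site d N) (i : Fin d) :
    x i - blockCorner b x i = (((x i).val % b : ℕ) : ZMod N) := by
  rw [sub_eq_iff_eq_add]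
  conv_lhs => rw [← ZMod.natCast_zmod_val (x i)]
  simp only [blockCorner]
  rw [← Nat.cast_add, Nat.mod_add_div']

/-- Sites whose block corners are `M` blocks near (one way round the torus or the other) are within
cyclic distance `b M + (b - 1)` coordinatewise. [folklore] -/
theorem natAbs_valMinAbs_sub_le_of_blockCorner_near {b M : ℕ} (hb : 1 ≤ b) (x x' : Site d N)
    (i : Fin d) (h : (blockCorner b x' i - blockCorner b x i).val ≤ b * M ∨
      (blockCorner b x i - blockCorner b x' i).val ≤ b * M) :
    ((x' i - x i).valMinAbs).natAbs ≤ b * M + (b - 1) := by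
  have hdec : x' i - x i = (blockCorner b x' i - blockCorner b x i) +
      ((((x' i).val % b : ℕ) : ZMod N) - (((x i).val % b : ℕ) : ZMod N)) := by
    rw [← apply_sub_blockCorner, ← apply_sub_blockCorner]; abel
  rw [hdec]
  refine (ZMod.natAbs_valMinAbs_add_le _ _).trans
    ((Int.natAbs_add_le _ _).trans (add_le_add ?_ ?_))
  · rcases h with h | h
    · exact ((ZMod.valMinAbs_natAbs_eq_min _).trans_le (min_le_left _ _)).trans h
    · rw [← neg_sub, ZMod.natAbs_valMinAbs_neg]
      exact ((ZMod.valMinAbs_natAbs_eq_min _).trans_le (min_le_left _ _)).trans h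
  · have hr : (x i).val % b < b := Nat.mod_lt _ hb
    have hr' : (x' i).val % b < b := Nat.mod_lt _ hb
    rw [← Int.cast_natCast, ← Int.cast_natCast ((x i).val % b), ← Int.cast_sub]
    refine (ZMod.natAbs_min_of_le_div_two N _ _ (ZMod.coe_valMinAbs _)
      (ZMod.natAbs_valMinAbs_le _)).trans ?_
    omega

/-- **Labels contract block nearness**: on the product frame of scale `b' ≥ 2b` with `(μ+1) b' ≤ N`,
two links whose blocks are `(2D+1)` blocks near lie in cells at coarse distance `≤ D + 1`. [folklore] -/
theorem cdist_cellOf_le_of_blockCorner_near (hb : 1 ≤ b) (hb' : 0 < b') (h2b : 2 * b ≤ b')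
    (h1 : μ * b' + b' ≤ N) (D : ℕ) (e e' : Edge d N)
    (hnear : ∀ i, (blockCorner b e'.1 i - blockCorner b e.1 i).val ≤ b * (2 * D + 1) ∨
      (blockCorner b e.1 i - blockCorner b e'.1 i).val ≤ b * (2 * D + 1)) :
    cdist (cellOf (prodFrame N b' μ) e') (cellOf (prodFrame N b' μ) e) ≤ D + 1 := by
  refine Finset.sup_le fun i _ => ?_
  refine (axisFrame_dist_le hb' h1 (e'.1 i) (e.1 i)).trans ?_
  have hcyc := natAbs_valMinAbs_sub_le_of_blockCorner_near hb e.1 e'.1 i (hnear i)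
  have hlt : b * (2 * D + 1) + (b - 1) < (D + 1) * b' := by
    have hm := Nat.mul_le_mul_left (D + 1) h2b
    have e1 : b * (2 * D + 1) = 2 * (b * D) + b := by ring
    have e2 : (D + 1) * (2 * b) = 2 * (b * D) + 2 * b := by ring
    omega
  have hdiv : ((e'.1 i - e.1 i).valMinAbs).natAbs / b' < D + 1 :=
    (Nat.div_lt_iff_lt_mul hb').2 (lt_of_le_of_lt hcyc hlt)
  omega

end Cells

/-! ### Supports of observables of `ℤ^d` and the time shift on the odd torus -/

section Lift

variable {d b' μ : ℕ}

/-- Each coordinate's cyclic distance is bounded by the coarse (`ℓ^∞`) distance. [folklore] -/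
theorem apply_cyclicDist_le_cdist {μc : Fin d → ℕ} (x y : CoarseIdx μc) (i : Fin d) :
    ((x i - y i).valMinAbs).natAbs ≤ cdist x y :=
  Finset.le_sup (f := fun i : Fin d => ((x i - y i).valMinAbs).natAbs) (Finset.mem_univ i)

/-- **Supports and the time shift on the odd torus**: the cells of the links of `SA` and of `SB`
shifted in time by `t ≤ S` are at coarse distance `≥ t/(2b') - (δ₀ + 1)` on `(ℤ/(2S+1))^d`, `δ₀`
the sum of the time extents of the two supports (no wrap-around for `t ≤ S`; labels expand
distances by `< 2b'`). [folklore] -/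
theorem le_cdist_cellOf_torusEdge_timeShift [NeZero d] (hb' : 0 < b') {S : ℕ}
    (h2 : 2 * S + 1 < μ * b' + 2 * b') (SA SB : Finset (ZdEdge d)) {t : ℕ} (ht : t ≤ S) :
    ∀ x ∈ SA.image (fun e => cellOf (prodFrame (2 * S + 1) b' μ) (torusEdge (2 * S + 1) e)),
      ∀ y ∈ SB.image (fun e => cellOf (prodFrame (2 * S + 1) b' μ)
        (torusEdge (2 * S + 1) (e.1 - -Pi.single (0 : Fin d) (t : ℤ), e.2))),
        t / (2 * b') - ((SA.sup fun e => (e.1 0).natAbs) + (SB.sup fun e => (e.1 0).natAbs) + 1) ≤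
          cdist x y := by
  intro x hx y hy
  obtain ⟨e, he, rfl⟩ := Finset.mem_image.1 hx
  obtain ⟨e', he', rfl⟩ := Finset.mem_image.1 hy
  refine le_trans ?_ (apply_cyclicDist_le_cdist _ _ 0)
  set X : ZMod (2 * S + 1) := ((e.1 0 : ℤ) : ZMod (2 * S + 1)) with hX
  set Y : ZMod (2 * S + 1) := ((e'.1 0 + t : ℤ) : ZMod (2 * S + 1)) with hY
  have hx0 : cellOf (prodFrame (2 * S + 1) b' μ) (torusEdge (2 * S + 1) e) 0 =
      axisFrame (2 * S + 1) b' μ X := rfl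
  have hv0 : (((e'.1 - -Pi.single (0 : Fin d) (t : ℤ) :
      Literature.Probability.LatticeModels.Site d) 0 : ℤ) : ZMod (2 * S + 1)) = Y := by
    rw [hY]; congr 1; simp
  have hy0 : cellOf (prodFrame (2 * S + 1) b' μ)
      (torusEdge (2 * S + 1) (e'.1 - -Pi.single (0 : Fin d) (t : ℤ), e'.2)) 0 =
      axisFrame (2 * S + 1) b' μ Y := by
    rw [← hv0]; rfl
  rw [hx0, hy0]
  have hexp := dist_lt_axisFrame_dist (μ := μ) hb' h2 X Y
  have hlow := le_natAbs_valMinAbs_sub_add (S := S) ht (e.1 0 - e'.1 0)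
  have hXY : X - Y = (((e.1 0 - e'.1 0) - t : ℤ) : ZMod (2 * S + 1)) := by
    rw [hX, hY]; push_cast; ring
  rw [← hXY] at hlow
  have hδ : (e.1 0 - e'.1 0).natAbs ≤
      (SA.sup fun e => (e.1 0).natAbs) + (SB.sup fun e => (e.1 0).natAbs) :=
    (Int.natAbs_sub_le _ _).trans (add_le_add
      (Finset.le_sup (f := fun e : ZdEdge d => (e.1 0).natAbs) he)
      (Finset.le_sup (f := fun e : ZdEdge d => (e.1 0).natAbs) he'))
  generalize (SA.sup fun e => (e.1 0).natAbs) + (SB.sup fun e => (e.1 0).natAbs) = δ₀ at *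
  generalize ((axisFrame (2 * S + 1) b' μ X - axisFrame (2 * S + 1) b' μ Y).valMinAbs).natAbs = c at *
  generalize ((X - Y).valMinAbs).natAbs = D at *
  rw [tsub_le_iff_right]
  refine Nat.div_le_of_le_mul ?_
  have hδ2 : δ₀ ≤ δ₀ * (2 * b') := Nat.le_mul_of_pos_right _ (by omega)
  have e1 : 2 * b' * (c + (δ₀ + 1)) = 2 * b' * (c + 1) + δ₀ * (2 * b') := by ring
  omega

end Lift

end Literature.MathematicalPhysics.QuantumFieldTheory
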